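import Mathlib
import HarnessLib

/-!
# Crux `NarrowRunsDie` (stmt-ResolutionOfSingularities-16882, route `WildCones`), line `derivlift` —
# stub `stub_slice`

Registered stub of the line skeleton `Cruxes/NarrowRunsDie/Lines/derivlift.lean` (v3), stated over the
route's inlined `let` calculus VERBATIM. See the skeleton docstring of `Sig.stub_slice` for the paper proof.
-/

noncomputable section

set_option linter.dupNamespace false

namespace Summit.ResolutionOfSingularities.ResolutionOfSingularities.Theorems.NarrowRunsDie

/-! ## Helpers for `stub_slice` (all prefixed `slice_`)

Proof outline. (0) `MultP c` gives `p ≤ ord (clean c)`, so the step divides by `u_i ^ p` and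
`step i τ c = clean c'`, `c' := tr i τ p (dv i p (bl i (clean c)))`. (1) The dictionary at `s = p`:
`σ(ser c) = X_i^p · Ser c'` (`σ = sub i τ = MvPowerSeries.subst fam`, `fam` the `sub` family
`X_i ↦ X_i`, `X_j ↦ X_i (X_j + τ_j)`). (2) `ser c` and `G := cone c` agree in degrees `≤ p`, so
`R := ser c - G` vanishes there and the dictionary at `s = p + 1` gives `X_i^(p+1) ∣ σ(R)`.
(3) `σ(G) = aeval fam G = X_i^p · g`, `g := aeval (X_i ↦ 1, X_j ↦ X_j + τ_j) G`, because
`fam = X_i · (1, X_j + τ_j)` and `G` is a form of degree `p`. (4)-(5) Compare the coefficients of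
`u^(A + p e_i)` (`A_i = 0`) in `X_i^p · Ser c' = X_i^p · g + X_i^(p+1) · Q`: `c' A = coeff_A g`;
finally re-apply the cleaning on both sides. -/

section SliceHelpers

variable {n : ℕ} {κ : Type} [Field κ]

/-- The `sub` family `X i ↦ X i`, `X j ↦ X i * (X j + C (τ j))` (`j ≠ i`) (verbatim `let` text) has
zero constant coefficients, hence substitution along it is an algebra map. -/
theorem slice_fam_hasSubst (i : Fin n) (τ : Fin n → κ) :
    MvPowerSeries.HasSubst (fun j : Fin n => @ite (MvPowerSeries (Fin n) κ) (j = i) (Classical.dec _)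
      (MvPowerSeries.X i) (MvPowerSeries.X i * (MvPowerSeries.X j + MvPowerSeries.C (τ j)))) :=
  MvPowerSeries.hasSubst_of_constantCoeff_zero (fun j => by
    by_cases h : j = i
    · rw [if_pos h]; simp
    · rw [if_neg h]; simp)

/-- The `sub` family is `X i` times the polynomial family `X i ↦ 1`, `X j ↦ X j + C (τ j)`. -/
theorem slice_fam_eq (i : Fin n) (τ : Fin n → κ) :
    (fun j : Fin n => @ite (MvPowerSeries (Fin n) κ) (j = i) (Classical.dec _)
      (MvPowerSeries.X i) (MvPowerSeries.X i * (MvPowerSeries.X j + MvPowerSeries.C (τ j)))) =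
      fun j : Fin n => MvPowerSeries.X i *
        (((if j = i then (1 : MvPolynomial (Fin n) κ) else MvPolynomial.X j + MvPolynomial.C (τ j) :
          MvPolynomial (Fin n) κ)) : MvPowerSeries (Fin n) κ) := by
  funext j
  by_cases h : j = i
  · rw [if_pos h, if_pos h, MvPolynomial.coe_one, mul_one]
  · rw [if_neg h, if_neg h, MvPolynomial.coe_add, MvPolynomial.coe_X, MvPolynomial.coe_C]

end SliceHelpers

/-- Scaling every variable by `x` multiplies the evaluation of a degree-`m` form by `x ^ m`. -/
theorem slice_aeval_mul_of_isHomogeneous {σ R S : Type*} [CommSemiring R] [CommSemiring S]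
    [Algebra R S] (φ : MvPolynomial σ R) {m : ℕ} (hφ : φ.IsHomogeneous m) (f : σ → S) (x : S) :
    MvPolynomial.aeval (fun j => x * f j) φ = x ^ m * MvPolynomial.aeval f φ := by
  classical
  conv_lhs => rw [φ.as_sum]
  conv_rhs => rw [φ.as_sum]
  simp only [map_sum, Finset.mul_sum]
  refine Finset.sum_congr rfl fun d hd => ?_
  rw [MvPolynomial.aeval_monomial, MvPolynomial.aeval_monomial, Finsupp.prod, Finsupp.prod]
  simp only [mul_pow, Finset.prod_mul_distrib, Finset.prod_pow_eq_pow_sum]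
  rw [← hφ.degree_eq_sum_deg_support hd]
  ring

/-- The coercion `MvPolynomial → MvPowerSeries` commutes with `aeval`. -/
theorem slice_coe_aeval {σ τ R : Type*} [CommSemiring R] (f : σ → MvPolynomial τ R)
    (φ : MvPolynomial σ R) :
    ((MvPolynomial.aeval f φ : MvPolynomial τ R) : MvPowerSeries τ R) =
      MvPolynomial.aeval (fun j => ((f j : MvPolynomial τ R) : MvPowerSeries τ R)) φ := by
  induction φ using MvPolynomial.induction_on with
  | C a =>
    rw [MvPolynomial.aeval_C, MvPolynomial.aeval_C, MvPolynomial.algebraMap_eq, MvPolynomial.coe_C]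
    rfl
  | add p q hp hq => rw [map_add, map_add, MvPolynomial.coe_add, hp, hq]
  | mul_X p k hp =>
    rw [map_mul, map_mul, MvPolynomial.coe_mul, hp, MvPolynomial.aeval_X, MvPolynomial.aeval_X]

/-- The algebraic heart of the slice computation: if `F` and the degree-`p` form `G` have the same
coefficients in degrees `≤ p`, `subst fam F = X_i^p · S` for a family `fam = X_i · g`, and
`subst fam` sends every series vanishing in degrees `≤ p` into `(X_i^(p+1))`, then the `X_i`-free
coefficients of `S` are those of `aeval g G` (`= G(v + u')` for the slice families). -/
theorem slice_main {n : ℕ} {κ : Type} [Field κ] (p : ℕ) (i : Fin n)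
    (fam : Fin n → MvPowerSeries (Fin n) κ) (g : Fin n → MvPolynomial (Fin n) κ)
    (hfam : MvPowerSeries.HasSubst fam)
    (hfg : fam = fun j : Fin n => MvPowerSeries.X i * ((g j : MvPolynomial (Fin n) κ) : MvPowerSeries (Fin n) κ))
    {F S : MvPowerSeries (Fin n) κ} (G : MvPolynomial (Fin n) κ) (hG : G.IsHomogeneous p)
    (hFG : ∀ d : Fin n →₀ ℕ, Finset.sum Finset.univ (fun j => d j) ≤ p →
      MvPowerSeries.coeff d F = MvPolynomial.coeff d G)
    (h1 : MvPowerSeries.subst fam F = MvPowerSeries.X i ^ p * S)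
    (hdict : ∀ R : MvPowerSeries (Fin n) κ,
      (∀ d : Fin n →₀ ℕ, MvPowerSeries.coeff d R ≠ 0 →
        p + 1 ≤ Finset.sum Finset.univ (fun j => d j)) →
      MvPowerSeries.X i ^ (p + 1) ∣ MvPowerSeries.subst fam R)
    (d : Fin n →₀ ℕ) (hd : d i = 0) :
    MvPowerSeries.coeff d S = MvPolynomial.coeff d (MvPolynomial.aeval g G) := by
  classical
  set R : MvPowerSeries (Fin n) κ := F - ↑G with hR
  have hRbd : ∀ e : Fin n →₀ ℕ, MvPowerSeries.coeff e R ≠ 0 →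
      p + 1 ≤ Finset.sum Finset.univ (fun j => e j) := by
    intro e he
    by_contra hlt
    apply he
    rw [hR, map_sub, MvPolynomial.coeff_coe, hFG e (by omega), sub_self]
  obtain ⟨Q, hQ⟩ := hdict R hRbd
  have hGsub : MvPowerSeries.subst fam (↑G : MvPowerSeries (Fin n) κ) =
      MvPowerSeries.X i ^ p *
        ((MvPolynomial.aeval g G : MvPolynomial (Fin n) κ) : MvPowerSeries (Fin n) κ) := by
    rw [MvPowerSeries.subst_coe, hfg, slice_aeval_mul_of_isHomogeneous G hG, slice_coe_aeval]
  have hFe : F = ↑G + R := by rw [hR]; ring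
  rw [hFe, MvPowerSeries.subst_add hfam, hGsub, hQ] at h1
  have e1 : MvPowerSeries.coeff (Finsupp.single i p + d) (MvPowerSeries.X i ^ p * S) =
      MvPowerSeries.coeff d S := by
    rw [MvPowerSeries.X_pow_eq, MvPowerSeries.coeff_add_monomial_mul, one_mul]
  have e2 : MvPowerSeries.coeff (Finsupp.single i p + d)
      (MvPowerSeries.X i ^ p *
        ((MvPolynomial.aeval g G : MvPolynomial (Fin n) κ) : MvPowerSeries (Fin n) κ)) =
      MvPolynomial.coeff d (MvPolynomial.aeval g G) := by
    rw [MvPowerSeries.X_pow_eq, MvPowerSeries.coeff_add_monomial_mul, one_mul,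
      MvPolynomial.coeff_coe]
  have e3 : MvPowerSeries.coeff (Finsupp.single i p + d) (MvPowerSeries.X i ^ (p + 1) * Q) = 0 :=
    MvPowerSeries.X_pow_dvd_iff.mp (dvd_mul_right _ Q) _ (by simp [hd])
  have key := congrArg (MvPowerSeries.coeff (Finsupp.single i p + d)) h1
  rw [map_add, e1, e2, e3, add_zero] at key
  exact key.symm

/-- Coefficients of the route's `cone` sum: the coefficient of `u^A` is `f A` if `|A| = p`, else `0`
(the line skeleton's `coeff_coneSum`, copied). -/
theorem slice_coeff_coneSum {κ : Type} [Field κ] (p n : ℕ) (f : (Fin n → ℕ) → κ) (A : Fin n →₀ ℕ) :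
    MvPolynomial.coeff A (Finset.sum (Fintype.piFinset (fun _ : Fin n => Finset.range (p + 1)))
      (fun B => @ite (MvPolynomial (Fin n) κ) (Finset.sum Finset.univ (fun j => B j) = p) (Classical.dec _)
        (MvPolynomial.monomial (Finsupp.equivFunOnFinite.symm B) (f B)) 0)) =
      if Finset.sum Finset.univ (fun j => A j) = p then f ⇑A else 0 := by
  classical
  rw [MvPolynomial.coeff_sum]
  have key : ∀ B ∈ Fintype.piFinset (fun _ : Fin n => Finset.range (p + 1)),
      MvPolynomial.coeff A (@ite (MvPolynomial (Fin n) κ) (Finset.sum Finset.univ (fun j => B j) = p)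
        (Classical.dec _) (MvPolynomial.monomial (Finsupp.equivFunOnFinite.symm B) (f B)) 0) =
      if B = ⇑A then (if Finset.sum Finset.univ (fun j => A j) = p then f ⇑A else 0) else 0 := by
    intro B _
    by_cases hB : B = ⇑A
    · subst hB
      rw [if_pos rfl]
      by_cases hs : Finset.sum Finset.univ (fun j => A j) = p
      · rw [if_pos hs, if_pos hs, MvPolynomial.coeff_monomial, if_pos (by simp)]
      · rw [if_neg hs, if_neg hs, MvPolynomial.coeff_zero]
    · rw [if_neg hB]
      by_cases hs : Finset.sum Finset.univ (fun j => B j) = p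
      · rw [if_pos hs, MvPolynomial.coeff_monomial, if_neg]
        intro h
        apply hB
        rw [← h]
        simp
      · rw [if_neg hs, MvPolynomial.coeff_zero]
  rw [Finset.sum_congr rfl key, Finset.sum_ite_eq']
  split_ifs with hmem hs
  · rfl
  · rfl
  · exfalso
    apply hmem
    rw [Fintype.mem_piFinset]
    intro j
    rw [Finset.mem_range]
    have : A j ≤ Finset.sum Finset.univ (fun j => A j) :=
      Finset.single_le_sum (f := fun j => A j) (fun _ _ => Nat.zero_le _) (Finset.mem_univ j)
    omega
  · rfl

/-- The route's `cone` sum is a form of degree `p` (the line skeleton's `isHomogeneous_coneSum`,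
copied). -/
theorem slice_isHomogeneous_coneSum {κ : Type} [Field κ] (p n : ℕ) (f : (Fin n → ℕ) → κ) :
    (Finset.sum (Fintype.piFinset (fun _ : Fin n => Finset.range (p + 1)))
      (fun B => @ite (MvPolynomial (Fin n) κ) (Finset.sum Finset.univ (fun j => B j) = p) (Classical.dec _)
        (MvPolynomial.monomial (Finsupp.equivFunOnFinite.symm B) (f B)) 0)).IsHomogeneous p := by
  classical
  rw [MvPolynomial.IsHomogeneous]
  intro d hd
  have h := slice_coeff_coneSum p n f d
  rw [h] at hd
  split_ifs at hd with hs
  · rw [← hs, Finsupp.weight_apply, Finsupp.sum_fintype]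
    · simp
    · simp
  · exact absurd rfl hd

/-- Stub `stub_slice` of line `derivlift` for crux `WildCones.NarrowRunsDie` (registered signature, verbatim). -/
theorem stub_slice :
  (  ∀ (n : ℕ) (κ : Type) [Field κ] (a : (Fin n → ℕ) → κ) (i : Fin n) (τ : Fin n → κ) (s : ℕ),
    let bl : Fin n → ((Fin n → ℕ) → κ) → ((Fin n → ℕ) → κ) := fun i c B => @ite κ (Finset.sum (Finset.univ.erase i) (fun j => B j) ≤ B i) (Classical.dec _) (c (Function.update B i (B i - Finset.sum (Finset.univ.erase i) (fun j => B j)))) 0;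
    let dv : Fin n → ℕ → ((Fin n → ℕ) → κ) → ((Fin n → ℕ) → κ) := fun i s c B => c (Function.update B i (B i + s));
    let tr : Fin n → (Fin n → κ) → ℕ → ((Fin n → ℕ) → κ) → ((Fin n → ℕ) → κ) := fun i τ s c B => Finset.sum (Fintype.piFinset (fun _ : Fin n => Finset.range (B i + s + 1))) (fun D => @ite κ (D i = 0) (Classical.dec _) (c (B + D) * Finset.prod (Finset.univ.erase i) (fun j => ((Nat.choose (B j + D j) (B j) : ℕ) : κ) * τ j ^ (D j))) 0);
    let sub : Fin n → (Fin n → κ) → MvPowerSeries (Fin n) κ → MvPowerSeries (Fin n) κ := fun i τ f => MvPowerSeries.subst (fun j : Fin n => @ite (MvPowerSeries (Fin n) κ) (j = i) (Classical.dec _) (MvPowerSeries.X i) (MvPowerSeries.X i * (MvPowerSeries.X j + MvPowerSeries.C (τ j)))) f;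
    (∀ A, a A ≠ 0 → s ≤ Finset.sum Finset.univ (fun j => A j)) →
    sub i τ (show MvPowerSeries (Fin n) κ from fun A : Fin n →₀ ℕ => a ⇑A) =
      MvPowerSeries.X i ^ s *
        (show MvPowerSeries (Fin n) κ from fun A : Fin n →₀ ℕ => tr i τ s (dv i s (bl i a)) ⇑A)) →
  ∀ p : ℕ, p.Prime → ∀ n : ℕ, 0 < n → ∀ (κ : Type) [Field κ] [CharP κ p] [PerfectField κ]
    (c : (Fin n → ℕ) → κ) (i : Fin n) (τ : Fin n → κ),
    let clean : ((Fin n → ℕ) → κ) → ((Fin n → ℕ) → κ) := fun c A => @ite κ (∀ j, p ∣ A j) (Classical.dec _) 0 (c A);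
    let bl : Fin n → ((Fin n → ℕ) → κ) → ((Fin n → ℕ) → κ) := fun i c B => @ite κ (Finset.sum (Finset.univ.erase i) (fun j => B j) ≤ B i) (Classical.dec _) (c (Function.update B i (B i - Finset.sum (Finset.univ.erase i) (fun j => B j)))) 0;
    let ord : ((Fin n → ℕ) → κ) → ℕ := fun c => sInf {m : ℕ | ∃ A, c A ≠ 0 ∧ m = Finset.sum Finset.univ (fun j => A j)};
    let dv : Fin n → ℕ → ((Fin n → ℕ) → κ) → ((Fin n → ℕ) → κ) := fun i s c B => c (Function.update B i (B i + s));
    let tr : Fin n → (Fin n → κ) → ℕ → ((Fin n → ℕ) → κ) → ((Fin n → ℕ) → κ) := fun i τ s c B => Finset.sum (Fintype.piFinset (fun _ : Fin n => Finset.range (B i + s + 1))) (fun D => @ite κ (D i = 0) (Classical.dec _) (c (B + D) * Finset.prod (Finset.univ.erase i) (fun j => ((Nat.choose (B j + D j) (B j) : ℕ) : κ) * τ j ^ (D j))) 0);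
    let step : Fin n → (Fin n → κ) → ((Fin n → ℕ) → κ) → ((Fin n → ℕ) → κ) := fun i τ c => clean (tr i τ (@ite ℕ (p ≤ ord (clean c)) (Classical.dec _) p 0) (dv i (@ite ℕ (p ≤ ord (clean c)) (Classical.dec _) p 0) (bl i (clean c))));
    let MultP : ((Fin n → ℕ) → κ) → Prop := fun c => (∃ A, clean c A ≠ 0) ∧ ∀ A, clean c A ≠ 0 → p ≤ Finset.sum Finset.univ (fun j => A j);
    let cone : ((Fin n → ℕ) → κ) → MvPolynomial (Fin n) κ := fun c => Finset.sum (Fintype.piFinset (fun _ : Fin n => Finset.range (p + 1))) (fun A => @ite (MvPolynomial (Fin n) κ) (Finset.sum Finset.univ (fun j => A j) = p) (Classical.dec _) (MvPolynomial.monomial (Finsupp.equivFunOnFinite.symm A) (clean c A)) 0);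
    MultP c → ∀ A : Fin n → ℕ, A i = 0 →
      step i τ c A = @ite κ (∀ j, p ∣ A j) (Classical.dec _) 0
        (MvPolynomial.coeff (Finsupp.equivFunOnFinite.symm A)
          (MvPolynomial.aeval (fun j : Fin n => if j = i then (1 : MvPolynomial (Fin n) κ) else MvPolynomial.X j + MvPolynomial.C (τ j)) (cone c))) := by
  intro hd p _ n _ κ _ _ _ c i τ clean bl ord dv tr step MultP cone hc A hAi
  -- (0) `MultP c` ⇒ `p ≤ ord (clean c)`: the step divides by `u_i ^ p`
  have hord : p ≤ ord (clean c) := by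
    apply le_csInf
    · obtain ⟨A₀, hA₀⟩ := hc.1
      exact ⟨_, A₀, hA₀, rfl⟩
    · rintro m ⟨B, hB, rfl⟩
      exact hc.2 B hB
  have hstep : step i τ c A = clean (tr i τ p (dv i p (bl i (clean c)))) A := by
    show clean (tr i τ (@ite ℕ (p ≤ ord (clean c)) (Classical.dec _) p 0)
      (dv i (@ite ℕ (p ≤ ord (clean c)) (Classical.dec _) p 0) (bl i (clean c)))) A = _
    rw [if_pos hord]
  -- the `sub` family (verbatim `let` text)
  let fam : Fin n → MvPowerSeries (Fin n) κ := fun j : Fin n => @ite (MvPowerSeries (Fin n) κ) (j = i)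
    (Classical.dec _) (MvPowerSeries.X i) (MvPowerSeries.X i * (MvPowerSeries.X j + MvPowerSeries.C (τ j)))
  -- (1) the dictionary for `a := clean c` at `s := p`
  have h1 : MvPowerSeries.subst fam
      (show MvPowerSeries (Fin n) κ from fun B : Fin n →₀ ℕ => clean c ⇑B) =
      MvPowerSeries.X i ^ p *
        (show MvPowerSeries (Fin n) κ from
          fun B : Fin n →₀ ℕ => tr i τ p (dv i p (bl i (clean c))) ⇑B) :=
    hd n κ (clean c) i τ p hc.2
  -- (2) `ser c` and `cone c` have the same coefficients in degrees `≤ p`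
  have hFG : ∀ d : Fin n →₀ ℕ, Finset.sum Finset.univ (fun j => d j) ≤ p →
      MvPowerSeries.coeff d (show MvPowerSeries (Fin n) κ from fun B : Fin n →₀ ℕ => clean c ⇑B) =
        MvPolynomial.coeff d (cone c) := by
    intro d hdp
    have e1 : MvPolynomial.coeff d (cone c) =
        if Finset.sum Finset.univ (fun j => d j) = p then clean c ⇑d else 0 :=
      slice_coeff_coneSum p n (clean c) d
    rw [e1]
    show clean c ⇑d = _
    split_ifs with h
    · rfl
    · by_contra hne
      have := hc.2 (⇑d) hne
      omega
  -- (2') the dictionary at `s := p + 1` for any series vanishing in degrees `≤ p`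
  have hdict : ∀ R : MvPowerSeries (Fin n) κ,
      (∀ d : Fin n →₀ ℕ, MvPowerSeries.coeff d R ≠ 0 →
        p + 1 ≤ Finset.sum Finset.univ (fun j => d j)) →
      MvPowerSeries.X i ^ (p + 1) ∣ MvPowerSeries.subst fam R := by
    intro R hR
    have hb : ∀ B : Fin n → ℕ, MvPowerSeries.coeff (Finsupp.equivFunOnFinite.symm B) R ≠ 0 →
        p + 1 ≤ Finset.sum Finset.univ (fun j => B j) := fun B hB => hR _ hB
    have h2 : MvPowerSeries.subst fam
        (show MvPowerSeries (Fin n) κ from fun B : Fin n →₀ ℕ =>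
          MvPowerSeries.coeff (Finsupp.equivFunOnFinite.symm ⇑B) R) =
        MvPowerSeries.X i ^ (p + 1) *
          (show MvPowerSeries (Fin n) κ from fun B : Fin n →₀ ℕ =>
            tr i τ (p + 1) (dv i (p + 1) (bl i (fun B' : Fin n → ℕ =>
              MvPowerSeries.coeff (Finsupp.equivFunOnFinite.symm B') R))) ⇑B) :=
      hd n κ (fun B' : Fin n → ℕ => MvPowerSeries.coeff (Finsupp.equivFunOnFinite.symm B') R) i τ
        (p + 1) hb
    have hRR : (show MvPowerSeries (Fin n) κ from fun B : Fin n →₀ ℕ =>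
        MvPowerSeries.coeff (Finsupp.equivFunOnFinite.symm ⇑B) R) = R := by
      refine MvPowerSeries.ext fun B => ?_
      show MvPowerSeries.coeff (Finsupp.equivFunOnFinite.symm ⇑B) R = _
      rw [Finsupp.equivFunOnFinite_symm_coe]
    rw [hRR] at h2
    exact ⟨_, h2⟩
  -- (3)-(5) the algebra (`slice_main`), after peeling off the cleaning on both sides
  rw [hstep]
  show @ite κ (∀ j, p ∣ A j) (Classical.dec _) 0 (tr i τ p (dv i p (bl i (clean c))) A) = _
  congr 1
  exact slice_main p i fam _ (slice_fam_hasSubst i τ) (slice_fam_eq i τ) (cone c)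
    (slice_isHomogeneous_coneSum p n (clean c)) hFG h1 hdict (Finsupp.equivFunOnFinite.symm A) hAi

end Summit.ResolutionOfSingularities.ResolutionOfSingularities.Theorems.NarrowRunsDie

end
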